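import Literature.MathematicalPhysics.QuantumFieldTheory.BalabanImbrieJaffe1984to88.BIJ88Sect3Statements
import Literature.MathematicalPhysics.QuantumFieldTheory.BalabanImbrieJaffe1984to88.BIJ85Sect1Model

/-!
# `BalabanImbrieJaffe1984to88.BIJ88Sect3ModelBridge` — the two typed carriers of the abelian Higgs model agree

statement-level skeleton of published theorems with citation tags; proofs where landed; nothing here is a claim about the Yang–Mills mass gap

T. Bałaban, J. Imbrie, A. Jaffe type the SAME lattice abelian Higgs model twice in the series: [BalabanImbrieJaffe1985] (1.1)–(1.2)
p. 300 on the UNIT lattice (`BIJ85Sect1Model.action`, r15: `u : PBond P j → Circle`) and [BalabanImbrieJaffe1988] (3.3)–(3.4) p. 265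
on the ε-lattice (`BIJ88Sect3Statements.action`, r18: ℂ-valued bond field / `GaugeField P j U1`, weights `w = ε^d`, `c = ε⁻¹`),
the latter becoming the former after the rescaling (3.6)–(3.10) p. 266 (*"We rescale our expressions from T_ε to the unit lattice
T₁. The scalar field is multiplied by ε^{−(d−2)/2}"*).  This file is the kernel-checked DICTIONARY between the two carriers (lit-balaban
INTERFACES-r18.md "carrier overlap"; for the DEFINITIONS steward r20 and ref-1): at `w = c = 1` the 1988 action with couplings
`(e, λ, δm², E₀, E₁)` IS the 1985 action with `e(ε) = e`, `λ(ε) = λ`, `(m² + δm²)ε² = 1 + 2δm²` and constant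
`E = E₀ + E₁ + |T|/(64λ)` (the 1988 potential (3.4) carries the completed-square constant `1/(64λ)` and bare mass 1, p. 266).
Rows `C2.Eq3.3`/`C2.Eq3.4` ↔ `C1.Eq1.1`/`C1.Eq1.2`.  Unit `lit-balaban-r18`.
-/

namespace Literature.MathematicalPhysics.QuantumFieldTheory.BalabanImbrieJaffe1984to88.BIJ88Sect3ModelBridge

open Literature.MathematicalPhysics.QuantumFieldTheory.Balaban1983to89
open scoped BigOperators
open Complex

variable {P : Params} {j : ℕ}

/-- kernel: the plaquette variables agree — `BIJ88Sect3Statements.plaqVar` of the ℂ-valued field `b ↦ ↑(u b)` is the coercion of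
`BIJ85Sect1Model.plaq u` (inverse on the circle = complex conjugate). [cite: BalabanImbrieJaffe1988, (3.3) p.265] -/
theorem plaqVar_coe (u : BIJ85Sect1Model.U1Field P j) (p : Plaq P j) :
    BIJ88Sect3Statements.plaqVar (fun b => (u b : ℂ)) p = ((BIJ85Sect1Model.plaq u p : Circle) : ℂ) := by
  simp only [BIJ88Sect3Statements.plaqVar, BIJ85Sect1Model.plaq, Circle.coe_mul, Circle.coe_inv_eq_conj]

/-- kernel: the covariant derivatives agree at `c = ε⁻¹ = 1`: `BIJ88Sect3Statements.covD 1 ↑u φ = BIJ85Sect1Model.covDeriv u φ`.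
[cite: BalabanImbrieJaffe1988, (3.3) p.265] -/
theorem covD_one_coe (u : BIJ85Sect1Model.U1Field P j) (φ : Balaban1983to89.Site P j → ℂ) (b : PBond P j) :
    BIJ88Sect3Statements.covD 1 (fun b => (u b : ℂ)) φ b = BIJ85Sect1Model.covDeriv u φ b := by
  simp [BIJ88Sect3Statements.covD, BIJ85Sect1Model.covDeriv]

/-- kernel: the potentials agree up to the constant `1/(64λ)`: (3.4) of 1988 with `(λ, δm²)` is (1.2) of 1985 with `λ(ε) = λ`,
`(m² + δm²)ε² = 1 + 2δm²`, plus `1/(64λ)`. [cite: BalabanImbrieJaffe1988, (3.4) p.265] -/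
theorem higgsP_eq_selfInt (lam dm2 : ℝ) (z : ℂ) :
    BIJ88Sect3Statements.higgsP lam dm2 z = BIJ85Sect1Model.selfInt lam (1 + 2 * dm2) z + 1 / (64 * lam) := by
  simp only [BIJ88Sect3Statements.higgsP, BIJ85Sect1Model.selfInt]
  ring

/-- kernel: **the two typed actions of the abelian Higgs model coincide on the unit lattice** — for a `Circle`-valued gauge field `u`
and `w = c = 1`, `S^{1988}_{(3.3)}(e, λ, δm², E₀, E₁)(↑u, φ) = S^{1985}_{(1.1)}(e(ε) = e, λ(ε) = λ, (m²+δm²)ε² = 1 + 2δm², E = E₀ + E₁ +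
|T₁|/(64λ))(u, φ)`. [cite: BalabanImbrieJaffe1988, (3.3) p.265] -/
theorem action_eq_BIJ85 (e lam dm2 E₀ E₁ : ℝ) (u : BIJ85Sect1Model.U1Field P j) (φ : Balaban1983to89.Site P j → ℂ) :
    BIJ88Sect3Statements.action 1 1 e lam dm2 E₀ E₁ (fun b => (u b : ℂ)) φ =
      BIJ85Sect1Model.action e lam (1 + 2 * dm2) (E₀ + E₁ + Fintype.card (Balaban1983to89.Site P j) * (1 / (64 * lam))) u φ := by
  simp only [BIJ88Sect3Statements.action, BIJ85Sect1Model.action, plaqVar_coe, covD_one_coe, higgsP_eq_selfInt, one_mul,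
    one_pow, Finset.sum_add_distrib, Finset.sum_const, Finset.card_univ, nsmul_eq_mul, one_div]
  ring

end Literature.MathematicalPhysics.QuantumFieldTheory.BalabanImbrieJaffe1984to88.BIJ88Sect3ModelBridge
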